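import Literature.AnabelianGeometry.AbsoluteAnabelian.NumberFieldValuationProSetTransport
import Literature.NumberTheory.GaloisRepresentations.NeukirchUchida
import HarnessLib

/-!
# `V⊚(F̄/F)` under an automorphism of `G_F` that is conjugation by a field automorphism:
# equivariant self-homeomorphism and permutation of decomposition groups (consumer of Neukirch–Uchida)

S. Mochizuki, *Topics in absolute anabelian geometry III* [MochizukiAbsTopIII2015], Def 5.1 (ii)–(iii) pp. 114–115
(functoriality of `V⊚(Π)` in `Π`; decomposition groups `Π_v` = stabilisers).

For the GENUINE valuation pro-set `NumberField.valuationProSet F` (abc-iut-L4-d2 p432664) and its transport along a field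
automorphism `τ : F̄ ≃+* F̄` (`NumberFieldValuationProSetTransport.lean`, p436550), THIS PROOF-ONLY FILE (0 definitions;
abc-iut-L4-d2, row «NONARCH-WIRING», abc-iut-L4-lead RULING #7w) records the two consequences the §5 number-field model
consumes, for an automorphism `α` of `G_F` related to `τ` by the Neukirch–Uchida relation (N0)
`(α σ) • (τ x) = τ (σ • x)`:

* `decomp_transport_of_rel` — **decomposition groups are permuted**: `Π_{τ v} = α(Π_v)` for every `v ∈ V⊚(F̄/F)` (in
  particular the N1-shape clauses of GAP G-L4d2g4-1 for BOTH non-archimedean and archimedean local elements,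
  `exists_decomp_nonArch_map_eq_of_rel`, `exists_decomp_arch_map_eq_of_rel`);
* `exists_equivariant_transport_of_exists_ringEquiv` — **the `α`-equivariant self-homeomorphism of `V⊚(F̄/F)`
  preserving `⊚`, `V^non`, `V^arc`** demanded by `GlobalAnabelianContext.mapProVal`/`mapProVal_smul`, from the mere
  EXISTENCE of such a `τ` — i.e. from the Neukirch–Uchida statement for `α` (the cell's named fact, typed by
  abc-iut-w5-d201; NOT asserted here: it enters as the hypothesis `h`).

Nothing here bears on [IUTchIII] Cor. 3.12 or takes a side; a named fact is a hypothesis, not a theorem.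
-/

noncomputable section

open scoped Pointwise Topology
open NumberField

namespace Literature.AnabelianGeometry.AbsoluteAnabelian.NumberFieldValuationProSet

open Field

variable (F : Type) [Field F]

/-- **Decomposition groups are permuted by transport**: if `(α σ) • (τ x) = τ (σ • x)` for all `σ, x` (N0), then for
every `v ∈ V⊚(F̄/F)` the decomposition group of `τ v` is `α` of the decomposition group of `v`.
[cite: MochizukiAbsTopIII2015, Def 5.1 (iii) p.115] -/
theorem decomp_transport_of_rel {α : absoluteGaloisGroup F ≃* absoluteGaloisGroup F}
    {τ : AlgebraicClosure F ≃+* AlgebraicClosure F}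
    (hτ : ∀ (σ : absoluteGaloisGroup F) (x : AlgebraicClosure F), (α σ) • (τ x) = τ (σ • x))
    (v : Carrier F) :
    (NumberField.valuationProSet F).decomp (transport F τ v) =
      ((NumberField.valuationProSet F).decomp v).map α.toMonoidHom := by
  letI := carrierAction F
  letI := carrierTopology F
  ext ρ
  rw [GaloisProSet.decomp, MulAction.mem_stabilizer_iff, Subgroup.mem_map]
  constructor
  · intro h
    refine ⟨α.symm ρ, ?_, by simp⟩
    rw [GaloisProSet.decomp, MulAction.mem_stabilizer_iff]
    have h1 : transport F τ (α.symm ρ • v) = transport F τ v := by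
      rw [transport_smul F hτ, MulEquiv.apply_symm_apply]
      exact h
    exact (transport F τ).injective h1
  · rintro ⟨σ, hσ, rfl⟩
    rw [GaloisProSet.decomp, MulAction.mem_stabilizer_iff] at hσ
    have hσ' : (letI := carrierAction F; σ • v) = v := hσ
    change α σ • transport F τ v = transport F τ v
    rw [← transport_smul F hτ, hσ']

/-- N1-shape, non-archimedean local elements: under (N0), `α` carries the decomposition group of every non-trivial
valuation ring of `F̄` onto the decomposition group of a non-trivial valuation ring (namely `τ(A)`).
[cite: MochizukiAbsTopIII2015, Def 5.1 (iii) p.115] -/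
theorem exists_decomp_nonArch_map_eq_of_rel {α : absoluteGaloisGroup F ≃* absoluteGaloisGroup F}
    {τ : AlgebraicClosure F ≃+* AlgebraicClosure F}
    (hτ : ∀ (σ : absoluteGaloisGroup F) (x : AlgebraicClosure F), (α σ) • (τ x) = τ (σ • x))
    (A : NonArch F) :
    ∃ B : NonArch F, ((NumberField.valuationProSet F).decomp (Sum.inr (Sum.inl A))).map α.toMonoidHom =
      (NumberField.valuationProSet F).decomp (Sum.inr (Sum.inl B)) :=
  ⟨nonArchTransport F τ A, by rw [← transport_inr_inl, decomp_transport_of_rel F hτ]⟩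

/-- N1-shape, archimedean local elements: under (N0), `α` carries the decomposition group of every infinite place of
`F̄` onto the decomposition group of an infinite place (namely `w ∘ τ⁻¹`). [cite: MochizukiAbsTopIII2015, Def 5.1 (iii) p.115] -/
theorem exists_decomp_arch_map_eq_of_rel {α : absoluteGaloisGroup F ≃* absoluteGaloisGroup F}
    {τ : AlgebraicClosure F ≃+* AlgebraicClosure F}
    (hτ : ∀ (σ : absoluteGaloisGroup F) (x : AlgebraicClosure F), (α σ) • (τ x) = τ (σ • x))
    (w : Arch F) :
    ∃ w' : Arch F, ((NumberField.valuationProSet F).decomp (Sum.inr (Sum.inr w))).map α.toMonoidHom =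
      (NumberField.valuationProSet F).decomp (Sum.inr (Sum.inr w')) :=
  ⟨archTransport F τ w, by rw [← transport_inr_inr, decomp_transport_of_rel F hτ]⟩

/-- **The `α`-equivariant self-homeomorphism of `V⊚(F̄/F)`** (what `GlobalAnabelianContext.mapProVal` /
`mapProVal_smul` demand at the number-field model), from the EXISTENCE of a field automorphism `τ` of `F̄` with
`(α σ) • (τ x) = τ (σ • x)` — the Neukirch–Uchida statement for `α`, taken as hypothesis `h` (NOT asserted): there is
`ψ : V⊚(F̄/F) ≃ₜ V⊚(F̄/F)` fixing `⊚`, preserving `V^non` and `V^arc`, with `ψ (σ • v) = α σ • ψ v`.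
[cite: MochizukiAbsTopIII2015, Def 5.1 (ii) p.114] -/
theorem exists_equivariant_transport_of_exists_ringEquiv
    (α : absoluteGaloisGroup F ≃ₜ* absoluteGaloisGroup F)
    (h : ∃ τ : AlgebraicClosure F ≃+* AlgebraicClosure F,
      ∀ (σ : absoluteGaloisGroup F) (x : AlgebraicClosure F), (α σ) • (τ x) = τ (σ • x)) :
    ∃ ψ : @Homeomorph (Carrier F) (Carrier F) (carrierTopology F) (carrierTopology F),
      ψ (NumberField.valuationProSet F).generic = (NumberField.valuationProSet F).generic ∧
      ψ '' (NumberField.valuationProSet F).non = (NumberField.valuationProSet F).non ∧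
      ψ '' (NumberField.valuationProSet F).arc = (NumberField.valuationProSet F).arc ∧
      ∀ (σ : absoluteGaloisGroup F) (v : Carrier F),
        (letI := carrierAction F; ψ (σ • v) = α σ • ψ v) := by
  obtain ⟨τ, hτ⟩ := h
  have hτ' : ∀ (σ : absoluteGaloisGroup F) (x : AlgebraicClosure F),
      (α.toMulEquiv σ) • (τ x) = τ (σ • x) := fun σ x => hτ σ x
  exact ⟨transport F τ, transport_generic F τ, image_transport_non F τ, image_transport_arc F τ,
    fun σ v => transport_smul F hτ' σ v⟩

/-- Under the same hypothesis, the decomposition groups of ALL local elements are permuted by `α` (N1 for `α`).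
[cite: MochizukiAbsTopIII2015, Def 5.1 (iii) p.115] -/
theorem exists_decomp_map_eq_of_exists_ringEquiv
    (α : absoluteGaloisGroup F ≃ₜ* absoluteGaloisGroup F)
    (h : ∃ τ : AlgebraicClosure F ≃+* AlgebraicClosure F,
      ∀ (σ : absoluteGaloisGroup F) (x : AlgebraicClosure F), (α σ) • (τ x) = τ (σ • x))
    (v : Carrier F) :
    ∃ v' : Carrier F, ((NumberField.valuationProSet F).decomp v).map α.toMulEquiv.toMonoidHom =
      (NumberField.valuationProSet F).decomp v' := by
  obtain ⟨τ, hτ⟩ := h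
  have hτ' : ∀ (σ : absoluteGaloisGroup F) (x : AlgebraicClosure F),
      (α.toMulEquiv σ) • (τ x) = τ (σ • x) := fun σ x => hτ σ x
  exact ⟨transport F τ v, (decomp_transport_of_rel F hτ' v).symm⟩

/-! ### v2: BY NAME from the cell's Neukirch–Uchida fact (abc-iut-w5-d201, `NeukirchUchida.lean`, p437013) -/

/-- **`mapProVal` at the number-field model, BY NAME from the named fact `NeukirchUchida F`** (the cell's typing of
[NSW] (12.2.1), abc-iut-w5-d201 p437013 — a HYPOTHESIS here, not a theorem; GAP G-L4d2g4-1): for every continuous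
automorphism `α` of `G_F` there is an `α`-equivariant self-homeomorphism of the genuine `V⊚(F̄/F)` fixing `⊚` and
preserving `V^non`, `V^arc`. [cite: NeukirchSchmidtWingberg2008, (12.2.1)] -/
theorem exists_equivariant_transport_of_neukirchUchida [NumberField F]
    (h : Literature.NumberTheory.GaloisRepresentations.NeukirchUchida F)
    (α : absoluteGaloisGroup F ≃ₜ* absoluteGaloisGroup F) :
    ∃ ψ : @Homeomorph (Carrier F) (Carrier F) (carrierTopology F) (carrierTopology F),
      ψ (NumberField.valuationProSet F).generic = (NumberField.valuationProSet F).generic ∧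
      ψ '' (NumberField.valuationProSet F).non = (NumberField.valuationProSet F).non ∧
      ψ '' (NumberField.valuationProSet F).arc = (NumberField.valuationProSet F).arc ∧
      ∀ (σ : absoluteGaloisGroup F) (v : Carrier F),
        (letI := carrierAction F; ψ (σ • v) = α σ • ψ v) :=
  exists_equivariant_transport_of_exists_ringEquiv F α
    (Literature.NumberTheory.GaloisRepresentations.NeukirchUchida.exists_ringEquiv_conj h α)

/-- **N1 BY NAME**: under `NeukirchUchida F`, every continuous automorphism of `G_F` permutes the decomposition groups
of ALL local elements of `V⊚(F̄/F)`. [cite: NeukirchSchmidtWingberg2008, (12.2.1)] -/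
theorem exists_decomp_map_eq_of_neukirchUchida [NumberField F]
    (h : Literature.NumberTheory.GaloisRepresentations.NeukirchUchida F)
    (α : absoluteGaloisGroup F ≃ₜ* absoluteGaloisGroup F) (v : Carrier F) :
    ∃ v' : Carrier F, ((NumberField.valuationProSet F).decomp v).map α.toMulEquiv.toMonoidHom =
      (NumberField.valuationProSet F).decomp v' :=
  exists_decomp_map_eq_of_exists_ringEquiv F α
    (Literature.NumberTheory.GaloisRepresentations.NeukirchUchida.exists_ringEquiv_conj h α) v

end Literature.AnabelianGeometry.AbsoluteAnabelian.NumberFieldValuationProSet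

end
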